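import Literature.AlgebraicGeometry.Motives.FiniteFlatCoordinates
import HarnessLib

/-!
# The `h⁰`-sandwich `r·h⁰(mD) ≤ h⁰((m+a) f^*D)`, `h⁰(m f^*D) ≤ r·h⁰((m+a)D)` for a finite
# morphism of degree `r` (cohomology-free comparison of sections under finite pullback)

Let `f : X → Y` be a finite dominant morphism of integral schemes over a field `K`,
`r = [K(X) : K(Y)]` (`= deg f`, the rank of `f` when `f` is moreover flat,
`FunctionFieldOver.finrank_eq_finrank_of_forall_eq`), and let `D` be a Cartier divisor on `Y`
admitting a section `s ∈ Γ(Y, 𝒪_Y(dD))` whose non-vanishing locus `Y_s` is *affine* and non-empty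
(e.g. `D` ample, `CartierDivisor.IsAmple`), `Y` quasi-compact. In the concrete model of
`Motives/CartierDivisor` (sections of `𝒪(nD)` are rational functions) this file constructs, for a
suitable shift `a` (a multiple of `d`) and every `m ≥ 0`, injective `K`-linear maps

* `Γ(Y, 𝒪_Y(mD))^r ↪ Γ(X, 𝒪_X((m+a) f^*D))`, `(u_l) ↦ ∑ f^♯(u_l) es_l`
  (`CartierDivisor.eventually_exists_linearMap_pi_sections`), where `es_l = (f^♯s)^N e_l` are global
  sections of `𝒪_X(a f^*D)` obtained from a `K(Y)`-basis `e_l` of `K(X)` of functions regular over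
  `f⁻¹(Y_s)` by the extension theorem Görtz–Wedhorn I, Thm. 7.22
  (`CartierDivisor.exists_isSection_pow_mul`);
* `Γ(X, 𝒪_X(m f^*D)) ↪ Γ(Y, 𝒪_Y((m+a)D))^r`, `σ ↦ (s^P c e^*_l(σ))_l`
  (`CartierDivisor.eventually_exists_linearMap_sections_pi`), where `e^*_l` are the coordinate
  functionals of that basis and `c` a common denominator (`Motives/FiniteFlatCoordinates`): over an
  affine `V ⊆ U_i` of a finite chart-subordinate cover, `f_i^m σ ∈ Γ(f⁻¹V, 𝒪_X) = ∑ Γ(V, 𝒪_Y) g_j`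
  and the coordinates of the finitely many generators `g_j` are regular on `V ∩ Y_s`, hence become
  regular on `V` after multiplication by a power of the local equation `f_i^d s` of `Y_s`
  (`Γ(D(t), 𝒪) = Γ(V, 𝒪)_t`, Görtz–Wedhorn I, (2.10.1)),

and deduces the **sandwich inequalities** `r · h⁰(mD) ≤ h⁰((m+a) f^*D)` and
`h⁰(m f^*D) ≤ r · h⁰((m+a)D)` whenever the larger space is finite-dimensional
(`CartierDivisor.exists_sandwich_h0`; `h0` carries the junk value `0` on infinite-dimensional
spaces). This is the classical sheaf-theoretic argument `𝒪_Y^r ↪ f_*𝒪_X(aD)`,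
`f_*𝒪_X ↪ 𝒪_Y(aD)^r` (a generically-basis family of sections of the rank-`r` sheaf `f_*𝒪_X` and
its dual) written out in function fields; it replaces the intersection-theoretic
`deg f^*𝓛 = deg f · deg 𝓛` (Görtz–Wedhorn II, Prop. 23.84) in asymptotic statements about `h⁰`
(`Motives/AbelianVarietyDegreePullback`).

Mathlib searched and used: `Module.finrank_pi_fintype`, `LinearMap.finrank_le_finrank_of_injective`,
`Module.Finite.of_injective`, `Fintype.linearIndependent_iff`, `Module.Basis.forall_coord_eq_zero_iff`,
`Filter.eventually_all_finset`, `Scheme.isBasis_affineOpens`, `IsCompact.elim_finite_subcover`;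
Mathlib has no Cartier divisors / line bundles on schemes (cf. `Motives/CartierDivisor`).

## References

* U. Görtz, T. Wedhorn, *Algebraic Geometry I: Schemes*, 2nd ed. (2020),
  doi:10.1007/978-3-658-30733-2: (2.10.1); Prop. 3.29 (PDF p. 102); Thm. 7.22 (PDF p. 230);
  (11.9), Prop. 11.21 (PDF pp. 373–374); (12.6) (PDF p. 414). [GortzWedhorn2020]
* U. Görtz, T. Wedhorn, *Algebraic Geometry II: Cohomology of Schemes* (2023),
  doi:10.1007/978-3-658-43031-3: Def. 23.76 (p. 445), Prop. 23.84 (p. 447) — the statement this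
  elementary comparison stands in for. [GortzWedhorn2023]
-/

universe u

open CategoryTheory AlgebraicGeometry TopologicalSpace Opposite Filter

noncomputable section

namespace Literature.AlgebraicGeometry.Motives

open RatFn FunctionFieldOver

namespace CartierDivisor

variable {X Y : Scheme.{u}} [IsIntegral X] [IsIntegral Y]

/-! ### Finite affine chart-subordinate covers -/

/-- On a quasi-compact integral scheme, every Cartier divisor `D = (U_i, f_i)` admits a finite
cover by affine opens each contained in some chart `U_i` (affine opens form a basis).
[folklore] -/
theorem exists_finite_affine_cover [CompactSpace Y] (D : CartierDivisor Y) :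
    ∃ (T : Finset Y) (i : Y → D.ι) (V : Y → Y.Opens), (∀ y, IsAffineOpen (V y)) ∧
      (∀ y, V y ≤ D.U (i y)) ∧ (∀ y, y ∈ V y) ∧ ∀ y' : Y, ∃ y ∈ T, y' ∈ V y := by
  classical
  choose i hi using D.covers
  have hVex : ∀ y : Y, ∃ V : Y.Opens, IsAffineOpen V ∧ y ∈ V ∧ V ≤ D.U (i y) := fun y => by
    obtain ⟨V, hVaff, hyV, hVU⟩ := (Opens.isBasis_iff_nbhd.1 Y.isBasis_affineOpens) (hi y)
    exact ⟨V, hVaff, hyV, hVU⟩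
  choose V hVaff hyV hVU using hVex
  obtain ⟨T, hT⟩ := isCompact_univ.elim_finite_subcover (fun y => (V y : Set Y))
    (fun y => (V y).isOpen) (fun y _ => Set.mem_iUnion.2 ⟨y, hyV y⟩)
  refine ⟨T, i, V, hVaff, hVU, hyV, fun y' => ?_⟩
  simpa using hT (Set.mem_univ y')

variable (f : X ⟶ Y) [IsDominant f] [IsFinite f]
variable (K : Type u) [Field K] [X.Over (Spec (.of K))] [Y.Over (Spec (.of K))]
  [f.IsOver (Spec (.of K))]
variable (D : CartierDivisor Y) {d : ℕ} {s : Y.functionField}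

/-- A section with a point in its non-vanishing locus is nonzero. [folklore] -/
theorem ne_zero_of_mem_nonvanishing' {E : CartierDivisor Y} {t : Y.functionField} {y : Y}
    (hy : y ∈ E.nonvanishing t) : t ≠ 0 := by
  obtain ⟨j, -, hu⟩ := hy
  exact fun h => hu.ne_zero (by rw [h, mul_zero])

/-! ### The lower bound: `Γ(Y, 𝒪(mD))^r ↪ Γ(X, 𝒪((m+a) f^*D))` -/

section Lower

variable {ι : Type} [Fintype ι]

/-- **Basis functions become global sections after multiplication by `(f^♯ s)^N`**: if the
`K(Y)`-basis `e_l` of `K(X)` consists of functions regular over `f⁻¹(Y_s)` (`s` a section of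
`𝒪_Y(dD)`), then `(f^♯ s)^N e_l ∈ Γ(X, 𝒪_X((dN) f^*D))` for one `N` and all `l`
(Görtz–Wedhorn I, Thm. 7.22 on the quasi-compact `X`, `CartierDivisor.exists_isSection_pow_mul`,
with `f⁻¹(Y_s) = X_{f^♯ s}`). [folklore] -/
theorem eventually_isSection_pow_mul_basis [CompactSpace Y] (hs : (d • D).IsSection s)
    (hη : genericPoint Y ∈ (d • D).nonvanishing s)
    (e : Module.Basis ι Y.functionField (FunctionFieldOver f))
    (he : ∀ l, e l ∈ Set.range (ofPreimageSection f (V := (d • D).nonvanishingOpens s) hη)) :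
    ∀ᶠ N : ℕ in atTop, ∀ l, ((d * N) • D.pullback f).IsSection
      (functionFieldMap f s ^ N * (of f).symm (e l)) := by
  haveI : CompactSpace X := QuasiCompact.compactSpace_of_compactSpace f
  have ht : (d • D.pullback f).IsSection (functionFieldMap f s) := by
    rw [← pullback_smul]; exact hs.pullback f
  -- each `e l` is regular over `f⁻¹(Y_s) = X_{f^♯ s}`
  have hreg : ∀ l, ∀ x ∈ (d • D.pullback f).nonvanishing (functionFieldMap f s),
      IsRegularAt x ((of f).symm (e l)) := fun l x hx => by
    obtain ⟨b, hb⟩ := he l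
    rw [← pullback_smul, ← preimage_nonvanishing f hs] at hx
    rw [← hb]
    exact isRegularAt_ofSection (U := f ⁻¹ᵁ (d • D).nonvanishingOpens s) hx b
  rw [eventually_all]
  intro l
  obtain ⟨N, hN⟩ := (D.pullback f).exists_isSection_pow_mul ht (hreg l)
  refine eventually_atTop.2 ⟨N, fun N' hN' => ?_⟩
  obtain ⟨k, rfl⟩ := Nat.exists_eq_add_of_le hN'
  rw [show d * (N + k) = d * k + d * N by ring, pow_add,
    show functionFieldMap f s ^ N * functionFieldMap f s ^ k * (of f).symm (e l) =
      functionFieldMap f s ^ k * (functionFieldMap f s ^ N * (of f).symm (e l)) by ring]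
  exact (ht.pow _ k).mul _ hN

/-- **The injection `Γ(Y, 𝒪(mD))^r ↪ Γ(X, 𝒪((m+a) f^*D))`, `(u_l)_l ↦ ∑_l f^♯(u_l) es_l`**, for a
`K(Y)`-basis `(e_l)` of `K(X)` of functions regular over `f⁻¹(Y_s)` and `es_l = (f^♯ s)^N e_l`
(`eventually_isSection_pow_mul_basis`, `a = dN`): `K`-linear, and injective by the `K(Y)`-linear
independence of the `e_l` (the sheaf map `𝒪_Y^r → f_*𝒪_X(aD)` given by `r` generically
independent sections). [folklore] -/
theorem eventually_exists_linearMap_pi_sections [CompactSpace Y] (hs : (d • D).IsSection s)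
    (hη : genericPoint Y ∈ (d • D).nonvanishing s)
    (e : Module.Basis ι Y.functionField (FunctionFieldOver f))
    (he : ∀ l, e l ∈ Set.range (ofPreimageSection f (V := (d • D).nonvanishingOpens s) hη)) :
    ∀ᶠ N : ℕ in atTop, ∀ m : ℕ,
      ∃ Φ : (ι → (m • D).sections K) →ₗ[K] ((m + d * N) • D.pullback f).sections K,
        Function.Injective Φ := by
  have hs0 : s ≠ 0 := ne_zero_of_mem_nonvanishing' hη
  refine (D.eventually_isSection_pow_mul_basis f hs hη e he).mono fun N hN m => ?_
  -- the sections `es l`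
  set es : ι → X.functionField := fun l => functionFieldMap f s ^ N * (of f).symm (e l) with hes
  have hmem : ∀ (u : ι → (m • D).sections K),
      ((m + d * N) • D.pullback f).IsSection (∑ l, functionFieldMap f (u l) * es l) := by
    intro u
    have h1 : ∀ l, ((m + d * N) • D.pullback f).IsSection (functionFieldMap f (u l) * es l) :=
      fun l => by
        have hu : (m • D.pullback f).IsSection (functionFieldMap f (u l)) := by
          rw [← pullback_smul]; exact (u l).2.pullback f
        exact hu.mul _ (hN l)
    exact (((m + d * N) • D.pullback f).sections K).sum_mem (fun l _ => h1 l)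
  refine ⟨{ toFun := fun u => ⟨∑ l, functionFieldMap f (u l) * es l, hmem u⟩
            map_add' := fun u v => ?_
            map_smul' := fun κ u => ?_ }, ?_⟩
  · apply Subtype.ext
    simp [add_mul, Finset.sum_add_distrib]
  · apply Subtype.ext
    simp [Algebra.smul_def, functionFieldMap_algebraMap, Finset.mul_sum, mul_assoc]
  · -- injectivity: `∑ f^♯(u_l) es_l = 0` forces `∑ u_l • e_l = 0` in `K(X)/K(Y)`
    intro u v huv
    have h := congrArg Subtype.val huv
    simp only [LinearMap.coe_mk, AddHom.coe_mk] at h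
    rw [← sub_eq_zero, ← Finset.sum_sub_distrib] at h
    have h' : ∑ l, functionFieldMap f ((u l : Y.functionField) - v l) * (of f).symm (e l) = 0 := by
      have e1 : ∑ l, (functionFieldMap f (u l) * es l - functionFieldMap f (v l) * es l) =
          functionFieldMap f s ^ N *
            ∑ l, functionFieldMap f ((u l : Y.functionField) - v l) * (of f).symm (e l) := by
        rw [Finset.mul_sum]
        refine Finset.sum_congr rfl fun l _ => ?_
        simp only [hes, map_sub]
        ring
      rw [e1, mul_eq_zero] at h
      exact h.resolve_left (pow_ne_zero _ ((map_ne_zero _).2 hs0))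
    -- in `FunctionFieldOver f` this is a vanishing `K(Y)`-linear combination of the basis
    have h'' : ∑ l, ((u l : Y.functionField) - v l) • e l = 0 := by
      apply (of f).symm.injective
      rw [map_sum, map_zero, ← h']
      refine Finset.sum_congr rfl fun l _ => ?_
      rw [Algebra.smul_def, map_mul]
      rfl
    have hli := Fintype.linearIndependent_iff.1 e.linearIndependent _ h''
    funext l
    exact Subtype.ext (sub_eq_zero.1 (hli l))

/-- **`r · h⁰(mD) ≤ h⁰((m+a) f^*D)`** (`r = [K(X) : K(Y)]`) for all `m`, whenever the right-hand
space of sections is finite-dimensional — from the injection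
`eventually_exists_linearMap_pi_sections` for a basis of functions regular over the affine
`f⁻¹(Y_s)` (`FunctionFieldOver.exists_basis_mem_range`). [folklore] -/
theorem eventually_mul_h0_le_h0_pullback [CompactSpace Y] (hs : (d • D).IsSection s)
    (hη : genericPoint Y ∈ (d • D).nonvanishing s)
    (haff : IsAffineOpen ((d • D).nonvanishingOpens s)) :
    ∀ᶠ N : ℕ in atTop, ∀ m : ℕ, FiniteDimensional K (((m + d * N) • D.pullback f).sections K) →
      Module.finrank Y.functionField (FunctionFieldOver f) * (m • D).h0 K ≤
        ((m + d * N) • D.pullback f).h0 K := by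
  obtain ⟨e, he⟩ := exists_basis_mem_range f haff hη
  refine (D.eventually_exists_linearMap_pi_sections f K hs hη e he).mono fun N hN m hfin => ?_
  obtain ⟨Φ, hΦ⟩ := hN m
  haveI : Module.Finite K (Fin (Module.finrank Y.functionField (FunctionFieldOver f)) →
      (m • D).sections K) := Module.Finite.of_injective Φ hΦ
  have hle := LinearMap.finrank_le_finrank_of_injective hΦ
  by_cases hr : Module.finrank Y.functionField (FunctionFieldOver f) = 0
  · rw [hr, zero_mul]; exact Nat.zero_le _
  · obtain ⟨l₀⟩ : Nonempty (Fin (Module.finrank Y.functionField (FunctionFieldOver f))) :=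
      ⟨⟨0, Nat.pos_of_ne_zero hr⟩⟩
    haveI : Module.Finite K ((m • D).sections K) :=
      Module.Finite.of_surjective (LinearMap.proj l₀ :
        (Fin (Module.finrank Y.functionField (FunctionFieldOver f)) → (m • D).sections K) →ₗ[K] _)
        (fun x => ⟨fun _ => x, rfl⟩)
    rw [Module.finrank_pi_fintype, Finset.sum_const, Finset.card_univ, Fintype.card_fin,
      smul_eq_mul] at hle
    exact hle

end Lower

/-! ### The upper bound: `Γ(X, 𝒪(m f^*D)) ↪ Γ(Y, 𝒪((m+a)D))^r` -/

section Upper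

variable {ι : Type} [Fintype ι] (hs : (d • D).IsSection s)
  (hη : genericPoint Y ∈ (d • D).nonvanishing s) (haff : IsAffineOpen ((d • D).nonvanishingOpens s))
  (e : Module.Basis ι Y.functionField (FunctionFieldOver f)) {c : Γ(Y, (d • D).nonvanishingOpens s)}
  (hc : ∀ (b : Γ(X, f ⁻¹ᵁ (d • D).nonvanishingOpens s)) (l : ι),
    ∃ a : Γ(Y, (d • D).nonvanishingOpens s),
      ofSection hη a = ofSection hη c * e.coord l (ofPreimageSection f hη b))

include hs haff hc in
/-- **Chartwise pole bound for coordinates of sections.** Let `V ⊆ U_i` be an affine open of `Y`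
inside a chart of `D`. There is `P` such that for every `m`, every `σ ∈ Γ(X, 𝒪_X(m f^*D))`
and every coordinate functional, `f_i^{m + dP} · s^P c e^*_l(σ)` is regular on `V`: indeed
`f_i^m σ ∈ Γ(f⁻¹V, 𝒪_X)` is a `Γ(V, 𝒪_Y)`-combination of finitely many generators, whose
coordinates (times `c`) are regular on `V ∩ Y_s = D_V(f_i^d s)`
(`FunctionFieldOver.isRegularAt_coord_of_forall_isRegularAt`), hence regular on `V` after
multiplication by `(f_i^d s)^P` (`Γ(D(t), 𝒪) = Γ(V, 𝒪)_t`, Görtz–Wedhorn I, (2.10.1)).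
[folklore] -/
theorem eventually_isRegularAt_chart {i : D.ι} {V : Y.Opens} (hVaff : IsAffineOpen V)
    (hVU : V ≤ D.U i) (hVη : genericPoint Y ∈ V) :
    ∀ᶠ P : ℕ in atTop, ∀ (m : ℕ) (σ : X.functionField), (m • D.pullback f).IsSection σ →
      ∀ l, ∀ y ∈ V, IsRegularAt y
        (D.f i ^ (m + d * P) * (s ^ P * (ofSection hη c * e.coord l (of f σ)))) := by
  classical
  -- notation and basic facts
  have hVX : genericPoint X ∈ f ⁻¹ᵁ V := genericPoint_mem_preimage f hVη
  set t : Y.functionField := D.f i ^ d * s with ht_def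
  have htreg : ∀ y ∈ V, IsRegularAt y t := fun y hy => hs i y (hVU hy)
  set tsec : Γ(Y, V) := sectionOf hVη t htreg with htsec_def
  have htsec : ofSection hVη tsec = t := ofSection_sectionOf _ _ _
  have ht0 : t ≠ 0 := mul_ne_zero (pow_ne_zero _ (D.f_ne_zero i)) (ne_zero_of_mem_nonvanishing' hη)
  have hηt : genericPoint Y ∈ Y.basicOpen tsec := by
    rw [genericPoint_mem_basicOpen_iff hVη, htsec]; exact ht0
  have hWV : (d • D).nonvanishing s ∩ (V : Set Y) = Y.basicOpen tsec :=
    D.nonvanishing_inter_eq_basicOpen hs hVU hVη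
  -- generators of `Γ(f⁻¹V, 𝒪_X)` over `Γ(V, 𝒪_Y)`
  letI := (f.app V).hom.toAlgebra
  have hfin : (f.app V).hom.Finite := IsFinite.finite_app f V hVaff
  haveI : Module.Finite Γ(Y, V) Γ(X, f ⁻¹ᵁ V) := hfin
  obtain ⟨G, hG⟩ := Module.finite_def.1 (inferInstance : Module.Finite Γ(Y, V) Γ(X, f ⁻¹ᵁ V))
  -- the coordinates (times `c`) of a function regular over `f⁻¹V` are regular on `V ∩ Y_s`,
  -- hence regular on `V` after multiplication by a power of `t`
  have hgen : ∀ (b : Γ(X, f ⁻¹ᵁ V)) (l : ι), ∃ P : ℕ, ∀ P', P ≤ P' → ∀ y ∈ V,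
      IsRegularAt y (t ^ P' * (ofSection hη c * e.coord l (ofPreimageSection f hVη b))) := by
    intro b l
    have hreg : ∀ y ∈ Y.basicOpen tsec,
        IsRegularAt y (ofSection hη c * e.coord l (ofPreimageSection f hVη b)) := by
      intro y hy
      have hy' : y ∈ (d • D).nonvanishing s ∩ (V : Set Y) := by rw [hWV]; exact hy
      refine isRegularAt_coord_of_forall_isRegularAt f haff hη e hc (V := V) ?_ l hy'.1 hy'.2
      intro x hx
      exact isRegularAt_ofSection (show x ∈ f ⁻¹ᵁ V from hx.2) b
    obtain ⟨P, a, hPa⟩ := exists_pow_mul_eq_ofSection hVaff tsec hηt hreg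
    rw [htsec] at hPa
    refine ⟨P, fun P' hP' y hy => ?_⟩
    obtain ⟨k, rfl⟩ := Nat.exists_eq_add_of_le hP'
    rw [pow_add, mul_comm (t ^ P) (t ^ k), mul_assoc, hPa]
    exact ((htreg y hy).pow k).mul (isRegularAt_ofSection hy a)
  -- a uniform exponent for the finitely many generators and coordinates
  have hev : ∀ᶠ P : ℕ in atTop, ∀ g ∈ G, ∀ l, ∀ y ∈ V,
      IsRegularAt y (t ^ P * (ofSection hη c * e.coord l (ofPreimageSection f hVη g))) := by
    rw [eventually_all_finset]
    intro g _
    rw [eventually_all]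
    intro l
    obtain ⟨P, hP⟩ := hgen g l
    exact eventually_atTop.2 ⟨P, hP⟩
  refine hev.mono fun P hP m σ hσ l y hy => ?_
  -- `f_i^m σ` is regular over `f⁻¹V`, hence a section `b'` there
  have hτ : ∀ x ∈ f ⁻¹ᵁ V, IsRegularAt x (functionFieldMap f (D.f i) ^ m * σ) := fun x hx =>
    hσ i x (show f x ∈ D.U i from hVU hx)
  set b' : Γ(X, f ⁻¹ᵁ V) := sectionOf hVX _ hτ with hb'_def
  have hb' : ofPreimageSection f hVη b' = (D.f i ^ m) • of f σ := by
    rw [ofPreimageSection_apply, hb'_def, ofSection_sectionOf, Algebra.smul_def, map_pow,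
      FunctionFieldOver.algebraMap_apply, map_mul, map_pow]
  -- every element of `Γ(f⁻¹V, 𝒪_X) = ∑ Γ(V, 𝒪_Y) g` has `t^P c e^*_l(·)` regular at `y`
  have key : ∀ b ∈ Submodule.span Γ(Y, V) (G : Set Γ(X, f ⁻¹ᵁ V)),
      IsRegularAt y (t ^ P * (ofSection hη c * e.coord l (ofPreimageSection f hVη b))) := by
    intro b hb
    induction hb using Submodule.span_induction with
    | mem g hg => exact hP g hg l y hy
    | zero =>
      rw [map_zero, map_zero, mul_zero, mul_zero]
      exact isRegularAt_zero
    | add b₁ b₂ _ _ h₁ h₂ =>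
      rw [map_add, map_add, mul_add, mul_add]
      exact h₁.add h₂
    | smul r b _ h =>
      have e1 : ofPreimageSection f hVη (r • b) = ofSection hVη r • ofPreimageSection f hVη b := by
        rw [Algebra.smul_def, RingHom.algebraMap_toAlgebra (f.app V).hom, map_mul,
          ofPreimageSection_app, Algebra.smul_def]
      rw [e1, LinearMap.map_smul, smul_eq_mul,
        show t ^ P * (ofSection hη c * (ofSection hVη r * e.coord l (ofPreimageSection f hVη b))) =
          ofSection hVη r * (t ^ P * (ofSection hη c * e.coord l (ofPreimageSection f hVη b)))
          by ring]
      exact (isRegularAt_ofSection hy r).mul h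
  have hb'mem : b' ∈ Submodule.span Γ(Y, V) (G : Set Γ(X, f ⁻¹ᵁ V)) := by rw [hG]; trivial
  have key' := key b' hb'mem
  rw [hb', LinearMap.map_smul, smul_eq_mul] at key'
  -- rearrange `t^P c (f_i^m e^*_l σ) = f_i^{m+dP} (s^P c e^*_l σ)`
  have e2 : t ^ P * (ofSection hη c * (D.f i ^ m * e.coord l (of f σ))) =
      D.f i ^ (m + d * P) * (s ^ P * (ofSection hη c * e.coord l (of f σ))) := by
    rw [ht_def, pow_add, pow_mul, mul_pow]; ring
  rwa [e2] at key'

include hs haff hc in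
/-- **Global pole bound**: there is `P` such that `s^P c e^*_l(σ) ∈ Γ(Y, 𝒪_Y((m + dP) D))` for
every `m`, every `σ ∈ Γ(X, 𝒪_X(m f^*D))` and every `l` (`eventually_isRegularAt_chart` on the
finitely many members of an affine chart-subordinate cover of the quasi-compact `Y`).
[folklore] -/
theorem eventually_isSection_pow_mul_coord [CompactSpace Y] :
    ∀ᶠ P : ℕ in atTop, ∀ (m : ℕ) (σ : X.functionField), (m • D.pullback f).IsSection σ → ∀ l,
      ((m + d * P) • D).IsSection (s ^ P * (ofSection hη c * e.coord l (of f σ))) := by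
  obtain ⟨T, i, V, hVaff, hVU, hyV, hcov⟩ := D.exists_finite_affine_cover
  have hev : ∀ᶠ P : ℕ in atTop, ∀ y₀ ∈ T, ∀ (m : ℕ) (σ : X.functionField),
      (m • D.pullback f).IsSection σ → ∀ l, ∀ y ∈ V y₀, IsRegularAt y
        (D.f (i y₀) ^ (m + d * P) * (s ^ P * (ofSection hη c * e.coord l (of f σ)))) := by
    rw [eventually_all_finset]
    intro y₀ _
    exact D.eventually_isRegularAt_chart f hs hη haff e hc (hVaff y₀) (hVU y₀)
      (genericPoint_mem_of_mem (hyV y₀))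
  refine hev.mono fun P hP m σ hσ l j y hyj => ?_
  obtain ⟨y₀, hy₀T, hyy₀⟩ := hcov y
  have key := hP y₀ hy₀T m σ hσ l y hyy₀
  rw [smul_f, show D.f j ^ (m + d * P) = (D.f j / D.f (i y₀)) ^ (m + d * P) *
      D.f (i y₀) ^ (m + d * P) by rw [div_pow, div_mul_cancel₀ _ (pow_ne_zero _ (D.f_ne_zero _))],
    mul_assoc]
  exact ((D.isUnitAt_div j (i y₀) y hyj (hVU y₀ hyy₀)).pow _).isRegularAt.mul key

include hs haff hc in
/-- **The injection `Γ(X, 𝒪(m f^*D)) ↪ Γ(Y, 𝒪((m+a)D))^r`, `σ ↦ (s^P c e^*_l(σ))_l`**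
(`a = dP` from `eventually_isSection_pow_mul_coord`): `K`-linear, and injective because the
`e^*_l` are the coordinate functionals of a basis and `s, c ≠ 0` (the sheaf map
`f_*𝒪_X → 𝒪_Y(aD)^r` dual to a generically-basis family of sections). [folklore] -/
theorem eventually_exists_linearMap_sections_pi [CompactSpace Y] (hc0 : c ≠ 0) :
    ∀ᶠ P : ℕ in atTop, ∀ m : ℕ,
      ∃ Ψ : ((m • D.pullback f).sections K) →ₗ[K] (ι → ((m + d * P) • D).sections K),
        Function.Injective Ψ := by
  have hs0 : s ≠ 0 := ne_zero_of_mem_nonvanishing' hη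
  have hc0' : ofSection hη c ≠ 0 :=
    (map_ne_zero_iff _ (germ_injective_of_isIntegral _ (genericPoint Y) hη)).2 hc0
  refine (D.eventually_isSection_pow_mul_coord f hs hη haff e hc).mono fun P hP m => ?_
  refine ⟨{ toFun := fun σ l => ⟨s ^ P * (ofSection hη c * e.coord l (of f σ)), hP m σ σ.2 l⟩
            map_add' := fun σ τ => ?_
            map_smul' := fun κ σ => ?_ }, ?_⟩
  · funext l
    apply Subtype.ext
    simp only [Submodule.coe_add, Pi.add_apply, map_add, mul_add]
  · funext l
    apply Subtype.ext
    simp only [Submodule.coe_smul, Pi.smul_apply, RingHom.id_apply, coord_of_smul f K]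
    rw [Algebra.smul_def, Algebra.smul_def]
    ring
  · intro σ τ h
    apply Subtype.ext
    apply (of f).injective
    rw [← sub_eq_zero, ← map_sub, ← e.forall_coord_eq_zero_iff]
    intro l
    have hl := congrArg (fun u : ι → ((m + d * P) • D).sections K => (u l : Y.functionField)) h
    simp only [LinearMap.coe_mk, AddHom.coe_mk] at hl
    have hl' : s ^ P * (ofSection hη c * (e.coord l (of f σ) - e.coord l (of f τ))) = 0 := by
      rw [mul_sub, mul_sub, hl, sub_self]
    rw [map_sub]
    simpa [hs0, hc0'] using hl'

include hs haff hc in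
/-- **`h⁰(m f^*D) ≤ r · h⁰((m+a)D)`** (`r` the cardinality of the index type of the basis, i.e.
`[K(X) : K(Y)]`) for all `m`, whenever `Γ(Y, 𝒪((m+a)D))` is finite-dimensional.
[folklore] -/
theorem eventually_h0_pullback_le_mul_h0 [CompactSpace Y] (hc0 : c ≠ 0) :
    ∀ᶠ P : ℕ in atTop, ∀ m : ℕ, FiniteDimensional K (((m + d * P) • D).sections K) →
      (m • D.pullback f).h0 K ≤ Fintype.card ι * ((m + d * P) • D).h0 K := by
  refine (D.eventually_exists_linearMap_sections_pi f K hs hη haff e hc hc0).mono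
    fun P hP m hfin => ?_
  obtain ⟨Ψ, hΨ⟩ := hP m
  have hle := LinearMap.finrank_le_finrank_of_injective hΨ
  rw [Module.finrank_pi_fintype, Finset.sum_const, Finset.card_univ, smul_eq_mul] at hle
  exact hle

end Upper

/-! ### The sandwich -/

/-- **The `h⁰`-sandwich for a finite morphism.** Let `f : X → Y` be a finite dominant
`K`-morphism of integral schemes, `Y` quasi-compact, `r = [K(X) : K(Y)]`, and let `D` be a
Cartier divisor on `Y` with a section `s ∈ Γ(Y, 𝒪(dD))` whose non-vanishing locus `Y_s` is affine
and non-empty. Then there is `a` such that for all `m ≥ 0`: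
`r · h⁰(mD) ≤ h⁰((m+a) f^*D)` and `h⁰(m f^*D) ≤ r · h⁰((m+a) D)`, each whenever the larger space
of sections is finite-dimensional (`eventually_mul_h0_le_h0_pullback`,
`eventually_h0_pullback_le_mul_h0`: both hold for all large shifts `a ∈ dℕ`). [folklore] -/
theorem exists_sandwich_h0 [CompactSpace Y] (hs : (d • D).IsSection s)
    (hη : genericPoint Y ∈ (d • D).nonvanishing s)
    (haff : IsAffineOpen ((d • D).nonvanishingOpens s)) :
    ∃ a : ℕ, ∀ m : ℕ,
      (FiniteDimensional K (((m + a) • D.pullback f).sections K) →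
        Module.finrank Y.functionField (FunctionFieldOver f) * (m • D).h0 K ≤
          ((m + a) • D.pullback f).h0 K) ∧
      (FiniteDimensional K (((m + a) • D).sections K) →
        (m • D.pullback f).h0 K ≤
          Module.finrank Y.functionField (FunctionFieldOver f) * ((m + a) • D).h0 K) := by
  obtain ⟨e, -⟩ := exists_basis_mem_range f haff hη
  obtain ⟨c, hc0, hc⟩ := exists_denominator f haff hη e
  have h₁ := D.eventually_mul_h0_le_h0_pullback f K hs hη haff
  have h₂ := D.eventually_h0_pullback_le_mul_h0 f K hs hη haff e hc hc0
  rw [Fintype.card_fin] at h₂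
  obtain ⟨N, hN₁, hN₂⟩ := (h₁.and h₂).exists
  exact ⟨d * N, fun m => ⟨hN₁ m, hN₂ m⟩⟩

end CartierDivisor

end Literature.AlgebraicGeometry.Motives

end
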